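import Summits.BirchSwinnertonDyer.Uniform.U2.HeegnerIndexDescent
import Summits.BirchSwinnertonDyer.Uniform.U2.GenusTwistRankTransport
import Literature.NumberTheory.EllipticCurves.VariableChangePointsMap
import Literature.NumberTheory.EllipticCurves.HeegnerPointsGaloisDescent
import Literature.NumberTheory.EllipticCurves.QuadraticTwistPadicReduction
import HarnessLib

/-!
# Track U2 (cell `bsd-uniform`, seat u2-p1): the INDEX LEMMA (L5) for the GENUS POINT —
# `k² · ĥ_L(P(χ)) = 2·[L:K]·a²·Reg(E^{(d)})` with `a, k` ODD (transport through the twist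
# `E^{(d)} ≅ E` over `L ∋ √d`, PROVED)

HONEST FRAMING (cell `bsd-uniform`, HOME run/shared/lean/pub/bsd-uniform/, verbatim in every file of
the seat): a RELATIVE ("twist-transport") theorem, uniform in the twisting parameter `d`, CONDITIONAL
on NAMED binders of two provenances (referee V17 C2-F1): PER BASE — `BSD₂(E) ∧ BSD₂(E^{(D)})`
(`hbsd`/`hbsd₀`), `Ш(E)[2] = Ш(E^{(D)})[2] = 0` (`hSha`/`hSha₀`), `r_an = 1 / 0` (`hr`/`hr₀`), (H-y)
`y_K ∉ 2E(K)` (`hHy`), `c(E)` odd (`hc`); PER TWIST PAIR `(E^{(d)}, E^{(d·d_K)})` — the (※) identity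
with odd indices `n, m` (`hId`) and the rank-`0` member's Zhai unit (`hZhai`); until each PER-TWIST-PAIR
binder is a tree theorem from base invariants, every transported pair is CERTIFICATE-DERIVED in that
binder, whatever the base. It converts PAIRS, never the class X5; books nothing; moves no census
number; no per-curve certificate is counted as a uniform theorem.

THIS FILE (support, theorems only; no `def`, no named fact) proves the genus-point half of the index
lemma L5 of `p2/idea-2/T4-PROOF.md` ("`ĥ_K(P(χ)) = 2n²·Reg(E^{(d)})`, `n` odd because
`P(χ) ∉ 2E^{(d)}(K)`"), in the RATIO form the (※) identity needs: for `E/ℚ` (model `W`), a quadratic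
field `K`, a finite Galois extension `L/K` containing `θ = √d ∉ K` (the ring class field `K[|d|]`),
the sign character `s(σ) = σ(θ)/θ` of `Gal(L/K)` (the genus character `χ_d`), `y ∈ E(L)` with the
composed trace `Σ_σ σy = m₀·y_K` (`m₀` odd), `E(L)[2] = 0` and (H-y) `y_K ∉ 2E(K)`, and models
`W₁ ≅ E^{(d)}` of rank `1`, `W₂ ≅ E^{(d·d_K)}` of rank `0`:
`k² · ĥ_L(P(s)) = 2·[L:K]·a²·Reg(W₁)` for ODD `a, k`, `P(s) = Σ_σ s(σ)·σy`.
Proof: `σP(s) = s(σ)·P(s)`; on the completed-square model `W' ≅ W` (`x ↦ x`, negation `y ↦ −y`) the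
coordinates of `P(s)` satisfy `σx = x`, `σy = s(σ)y`, so `x, y/θ ∈ K` (Galois descent) and `P(s)` is
the image of a point `Q' ∈ E^{(d)}(K)` under the twisting map `τ : (X, Y) ↦ (X/θ², Y/θ³)` (tree
`QuadraticDescent.twistMap`, Silverman AEC X.2 / Exercise 10.16), with `ĥ_L(P(s)) = [L:K]·ĥ_K(Q')`
(heights are invariant under changes of variables and scale with the degree under base change); `Q'`
is not twice a point of `E^{(d)}(K)` (else `P(s) ∈ 2E(L)`, contradicting the parity transport of
(H-y), `GenusCongruence`); then the ℚ-level engine `HeegnerIndex.exists_odd_sq_mul_canonicalHeight_eq`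
(`rank E^{(d)}(K) = rank E^{(d)}(ℚ) + rank E^{(d·d_K)}(ℚ) = 1`) gives `k²·ĥ_K(Q') = 2·a²·Reg(W₁)`.

References: Silverman AEC VIII.9.3, X.2 Prop. 2.4, X.5 Cor. 5.4, Exercise 10.16 [SilvermanAEC2009];
Gross–Zagier 1986 I.(6.3)–(6.5) [GrossZagier1986]; `p2/idea-2/T4-PROOF.md` v1.9b L5 (evidence).
-/

noncomputable section

open scoped Classical

open Module WeierstrassCurve WeierstrassCurve.Affine.Point Literature.NumberTheory.EllipticCurves

namespace Summit.BirchSwinnertonDyer.Uniform.U2.HeegnerIndex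

universe u

/-! ## §1 Instance-generic helpers (canonical height under casts and changes of variables) -/

section Helpers

variable {F : Type*} [Field F] [NumberField F]

/-- Transport along an equality of Weierstrass equations does not change the canonical height.
[folklore] -/
theorem canonicalHeight_congrEquiv [DecidableEq F] {W₁ W₂ : WeierstrassCurve F} (h : W₁ = W₂)
    (P : W₁.toAffine.Point) :
    canonicalHeight (Affine.Point.congrEquiv h P) = canonicalHeight P := by
  subst h; rfl

/-- The isomorphism `W(L) ≃+ (C • W)(L)` of a change of variables defined over the base field
preserves the canonical height (Silverman AEC VIII.9, `ĥ` is attached to `E/K`; tree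
`canonicalHeight_pointEquiv`), for ANY `DecidableEq` instance on `L`. [cite: SilvermanAEC2009, Prop. VIII.9.1] -/
theorem canonicalHeight_pointEquivBaseChange {R : Type*} [Field R] (W : WeierstrassCurve R)
    (C : VariableChange R) (L : Type*) [Field L] [NumberField L] [Algebra R L] [hdec : DecidableEq L]
    (P : (W.baseChange L).toAffine.Point) :
    canonicalHeight (VariableChange.pointEquivBaseChange W C L P) = canonicalHeight P := by
  have h : hdec = fun a b => Classical.propDecidable (a = b) := Subsingleton.elim _ _
  subst h
  unfold VariableChange.pointEquivBaseChange
  rw [AddEquiv.trans_apply, canonicalHeight_congrEquiv, canonicalHeight_pointEquiv]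

end Helpers

/-! ## §2 The Galois action on the genus point: `σ P(s) = s(σ) · P(s)` -/

section Galois

variable (W : WeierstrassCurve ℚ) {K : Type} [Field K] [NumberField K]
  {L : Type} [Field L] [NumberField L] [Algebra K L]

/-- **`σ · P(s) = s(σ) · P(s)`** for a `±1`-valued character `s` of `Gal(L/K)` and
`P(s) = Σ_τ s(τ)·τy`: reindex `τ ↦ στ` and use `s(σ⁻¹τ') = s(σ)·s(τ')` (`s(σ)² = 1`). [folklore] -/
theorem map_genusPoint_eq_smul (s : (L ≃ₐ[K] L) →* ℤˣ) (y : (W.baseChange L).toAffine.Point)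
    (σ : L ≃ₐ[K] L) :
    Affine.Point.map (W' := W) (σ : L →ₐ[K] L)
        (∑ τ : L ≃ₐ[K] L, (s τ : ℤ) • Affine.Point.map (W' := W) (τ : L →ₐ[K] L) y) =
      (s σ : ℤ) • ∑ τ : L ≃ₐ[K] L, (s τ : ℤ) • Affine.Point.map (W' := W) (τ : L →ₐ[K] L) y := by
  rw [map_sum, Finset.smul_sum]
  simp only [map_zsmul, Affine.Point.map_map]
  -- reindex `τ ↦ σ * τ`
  have hcomp : ∀ τ : L ≃ₐ[K] L, ((σ : L →ₐ[K] L).comp (τ : L →ₐ[K] L)) = ((σ * τ : L ≃ₐ[K] L) : L →ₐ[K] L) :=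
    fun τ => rfl
  simp only [hcomp]
  refine Fintype.sum_equiv (Equiv.mulLeft σ) _ _ fun τ => ?_
  simp only [Equiv.coe_mulLeft, smul_smul]
  congr 1
  rw [map_mul, Units.val_mul, ← mul_assoc, ← Units.val_mul, Int.units_mul_self, Units.val_one,
    one_mul]

end Galois


/-! ## §3 The index lemma for the genus point -/

section Transport

variable (W : WeierstrassCurve ℚ) [W.IsElliptic] {K : Type} [Field K] [NumberField K]
  {L : Type} [Field L] [NumberField L] [Algebra K L]

omit [W.IsElliptic] in
/-- `Point.map` along `σ : L ≃ₐ[K] L` only depends on the underlying ring map: restricting scalars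
to `ℚ` gives the same map on points. [folklore] -/
theorem map_restrictScalars (σ : L ≃ₐ[K] L) (P : (W.baseChange L).toAffine.Point) :
    Affine.Point.map (W' := W) ((σ.restrictScalars ℚ : L ≃ₐ[ℚ] L) : L →ₐ[ℚ] L) P =
      Affine.Point.map (W' := W) (σ : L →ₐ[K] L) P := by
  cases P <;> rfl

omit [W.IsElliptic] in
/-- Transport along an equality of `ℚ`-models commutes with the Galois action on `L`-points.
[folklore] -/
theorem congrEquiv_map_of_eq {X₁ X₂ : WeierstrassCurve ℚ} (h : X₁ = X₂)
    (hL : X₁.baseChange L = X₂.baseChange L) (σ : L ≃ₐ[K] L)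
    (Q : (X₁.baseChange L).toAffine.Point) :
    Affine.Point.congrEquiv hL (Affine.Point.map (W' := X₁) (σ : L →ₐ[K] L) Q) =
      Affine.Point.map (W' := X₂) (σ : L →ₐ[K] L) (Affine.Point.congrEquiv hL Q) := by
  subst h; rfl

/-- Base change is transitive along `ℚ → K → L` (the `ℚ`-algebra structure of `L` is unique).
[folklore] -/
theorem baseChange_baseChange_rat (V : WeierstrassCurve ℚ) :
    (V.baseChange K).baseChange L = V.baseChange L := by
  simp only [WeierstrassCurve.baseChange, WeierstrassCurve.map_map]
  congr 1
  exact Subsingleton.elim _ _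

/-- **THE INDEX LEMMA FOR THE GENUS POINT (L5, ratio form) — PROVED.** Data: `E/ℚ` (model `W`),
models `W₁ ≅ E^{(d)}` of Mordell–Weil rank `1` and `W₂ ≅ E^{(d·d_K)}` of rank `0`; `K` a quadratic
field, `L/K` finite Galois (the ring class field) with `θ ∈ L`, `θ² = d`, `θ ∉ K`; a `±1`-valued
character `s` of `Gal(L/K)` with `σθ = s(σ)θ` (the genus character); `y ∈ E(L)` with composed trace
`Σ_σ σy = m₀ · y_K`, `m₀` odd; `E(L)[2] = 0`; (H-y) `y_K ∉ 2E(K)`. Then for the genus point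
`P(s) = Σ_σ s(σ)·σy` there are ODD `a, k` with `k² · ĥ_L(P(s)) = 2·[L:K]·a²·Reg(W₁)`.
[cite: SilvermanAEC2009, X.2 Prop. 2.4, X.5 Cor. 5.4, Exercise 10.16, Thm. VIII.9.3]
[cite: GrossZagier1986, I.(6.3)–(6.5)] -/
theorem exists_odd_sq_mul_canonicalHeight_genusPoint (W₁ W₂ : WeierstrassCurve ℚ) [W₁.IsElliptic]
    [W₂.IsElliptic] {d : ℤ} (hd : d ≠ 0)
    (h₁ : ∃ C : VariableChange ℚ, C • W₁ = W.quadraticTwist (d : ℚ))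
    (hK2 : finrank ℚ K = 2)
    (h₂ : ∃ C : VariableChange ℚ, C • W₂ = W.quadraticTwist ((d * NumberField.discr K : ℤ) : ℚ))
    (hrk₁ : W₁.mordellWeilRank = 1) (hrk₂ : W₂.mordellWeilRank = 0)
    [IsGalois K L] [hdec : DecidableEq L]
    (θ : L) (hθd : θ ^ 2 = (d : L)) (hθK : θ ∉ Set.range (algebraMap K L))
    (s : (L ≃ₐ[K] L) →* ℤˣ) (hs : ∀ σ : L ≃ₐ[K] L, σ θ = ((s σ : ℤ) : L) * θ)
    (y : (W.baseChange L).toAffine.Point) (yK : (W.baseChange K).toAffine.Point) {m₀ : ℤ}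
    (hm₀ : Odd m₀)
    (htr : ∑ σ : L ≃ₐ[K] L, Affine.Point.map (W' := W) (σ : L →ₐ[K] L) y =
      m₀ • Affine.Point.baseChange (W' := W) K L yK)
    (h2L : ∀ Q : (W.baseChange L).toAffine.Point, (2 : ℕ) • Q = 0 → Q = 0)
    (hHy : ¬ ∃ R : (W.baseChange K).toAffine.Point, (2 : ℕ) • R = yK) :
    ∃ a k : ℕ, Odd a ∧ Odd k ∧
      (k : ℝ) ^ 2 * canonicalHeight (∑ σ : L ≃ₐ[K] L, (s σ : ℤ) •
          Affine.Point.map (W' := W) (σ : L →ₐ[K] L) y) =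
        2 * (finrank K L : ℝ) * (a : ℝ) ^ 2 * W₁.regulator := by
  -- normalise the `DecidableEq` instance to the classical one (all tree lemmas are stated with it)
  have hinst : hdec = fun a b => Classical.propDecidable (a = b) := Subsingleton.elim _ _
  subst hinst
  haveI : FiniteDimensional K L := Module.Finite.right ℚ K L
  have hdQ : (d : ℚ) ≠ 0 := by exact_mod_cast hd
  have hθ0 : θ ≠ 0 := fun h => by
    rw [h, zero_pow two_ne_zero] at hθd
    exact hd (by exact_mod_cast hθd.symm)
  -- §a the genus point and its Galois behaviour
  set Ps : (W.baseChange L).toAffine.Point := ∑ σ : L ≃ₐ[K] L, (s σ : ℤ) •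
    Affine.Point.map (W' := W) (σ : L →ₐ[K] L) y with hPs
  have hGal : ∀ σ : L ≃ₐ[K] L, Affine.Point.map (W' := W) (σ : L →ₐ[K] L) Ps = (s σ : ℤ) • Ps :=
    fun σ => map_genusPoint_eq_smul W s y σ
  have hPs_ne : ¬ IsOfFinAddOrder Ps := genusPoint_not_isOfFinAddOrder W yK y h2L hHy s hm₀ htr
  -- §b the completed-square model `W' ≅ W` and the point `P = e(P(s))` on it
  obtain ⟨C₁, hC₁⟩ := W.exists_variableChange_quadraticTwist_one
  set W' : WeierstrassCurve ℚ := W.quadraticTwist 1 with hW'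
  have hC₁L : (C₁ • W).baseChange L = W'.baseChange L := by rw [hC₁]
  let e : (W.baseChange L).toAffine.Point ≃+ (W'.baseChange L).toAffine.Point :=
    (VariableChange.pointEquivBaseChange W C₁ L).trans (Affine.Point.congrEquiv hC₁L)
  have he_map : ∀ (σ : L ≃ₐ[K] L) (P : (W.baseChange L).toAffine.Point),
      e (Affine.Point.map (W' := W) (σ : L →ₐ[K] L) P) =
        Affine.Point.map (W' := W') (σ : L →ₐ[K] L) (e P) := by
    intro σ P
    show Affine.Point.congrEquiv hC₁L (VariableChange.pointEquivBaseChange W C₁ L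
        (Affine.Point.map (W' := W) (σ : L →ₐ[K] L) P)) =
      Affine.Point.map (W' := W') (σ : L →ₐ[K] L)
        (Affine.Point.congrEquiv hC₁L (VariableChange.pointEquivBaseChange W C₁ L P))
    rw [← map_restrictScalars W σ P, VariableChange.pointEquivBaseChange_map_algEquiv,
      map_restrictScalars (C₁ • W) σ, congrEquiv_map_of_eq hC₁ hC₁L σ]
  have he_h : ∀ P : (W.baseChange L).toAffine.Point, canonicalHeight (e P) = canonicalHeight P := by
    intro P
    show canonicalHeight (Affine.Point.congrEquiv hC₁L (VariableChange.pointEquivBaseChange W C₁ L P)) = _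
    rw [canonicalHeight_congrEquiv, canonicalHeight_pointEquivBaseChange]
  set P := e Ps with hPdef
  have hP0 : P ≠ 0 := by
    intro h
    apply hPs_ne
    have : Ps = 0 := by
      apply e.injective
      rw [← hPdef, h, _root_.map_zero]
    rw [this]
    exact IsOfFinAddOrder.zero
  have hPGal : ∀ σ : L ≃ₐ[K] L, Affine.Point.map (W' := W') (σ : L →ₐ[K] L) P = (s σ : ℤ) • P := by
    intro σ
    rw [hPdef, ← he_map, hGal, map_zsmul]
  -- §c coordinates: `P = (x, y₀)` with `σx = x`, `σy₀ = s(σ)·y₀`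
  obtain ⟨x, y₀, hxy, hPxy⟩ : ∃ (x y₀ : L) (h : (W'.baseChange L).toAffine.Nonsingular x y₀),
      P = .some x y₀ h := by
    rcases hP' : P with _ | ⟨x, y₀, h⟩
    · exact absurd hP' hP0
    · exact ⟨x, y₀, h, rfl⟩
  have ha₁ : (W'.baseChange L).a₁ = 0 := by simp [hW', WeierstrassCurve.baseChange, quadraticTwist]
  have ha₃ : (W'.baseChange L).a₃ = 0 := by simp [hW', WeierstrassCurve.baseChange, quadraticTwist]
  have hcoord : ∀ σ : L ≃ₐ[K] L, σ x = x ∧ σ y₀ = ((s σ : ℤ) : L) * y₀ := by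
    intro σ
    have h := hPGal σ
    rw [hPxy, Affine.Point.map_some] at h
    rcases Int.units_eq_one_or (s σ) with h1 | h1
    · rw [h1, Units.val_one, one_zsmul, Affine.Point.some.injEq] at h
      rw [h1, Units.val_one, Int.cast_one, one_mul]
      exact ⟨h.1, h.2⟩
    · rw [h1, Units.val_neg, Units.val_one, neg_one_zsmul, Affine.Point.neg_some,
        Affine.Point.some.injEq] at h
      obtain ⟨hx, hy⟩ := h
      refine ⟨hx, ?_⟩
      have hy' : σ y₀ = (W'.baseChange L).toAffine.negY x y₀ := hy
      rw [hy', h1, Units.val_neg, Units.val_one, Int.cast_neg, Int.cast_one, Affine.negY, ha₁, ha₃]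
      ring
  -- §d Galois descent of the coordinates: `x ∈ K`, `y₀ = b·θ` with `b ∈ K`
  obtain ⟨a, ha⟩ : x ∈ Set.range (algebraMap K L) :=
    (IsGalois.mem_range_algebraMap_iff_fixed x).mpr fun σ => (hcoord σ).1
  obtain ⟨b, hb⟩ : y₀ * θ⁻¹ ∈ Set.range (algebraMap K L) := by
    refine (IsGalois.mem_range_algebraMap_iff_fixed _).mpr fun σ => ?_
    rw [map_mul, map_inv₀, (hcoord σ).2, hs σ]
    rcases Int.units_eq_one_or (s σ) with h1 | h1 <;> simp [h1]
  have hb' : algebraMap K L b * θ = y₀ := by rw [hb, inv_mul_cancel_right₀ hθ0]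
  -- §e the twisting map over `K`: `U = W'_K`, `τ : U^{(d)}(K) → U(L)`
  haveI hW'ell : W'.IsElliptic := W.isElliptic_quadraticTwist one_ne_zero
  set U : WeierstrassCurve K := W'.baseChange K with hU
  haveI hUell : U.IsElliptic := inferInstanceAs (W'.map (algebraMap ℚ K)).IsElliptic
  haveI : (U.quadraticTwist (d : K)).IsElliptic :=
    U.isElliptic_quadraticTwist (by exact_mod_cast hd)
  have hθsq : θ ^ 2 = algebraMap K L (d : K) := by rw [map_intCast, hθd]
  have hU1 : U.quadraticTwist 1 = U := by
    rw [hU, WeierstrassCurve.baseChange, ← map_one (algebraMap ℚ K), ← map_quadraticTwist, hW',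
      quadraticTwist_quadraticTwist, one_mul]
  have E₁ : (U.quadraticTwist 1).baseChange L = W'.baseChange L := by
    rw [hU1, hU, baseChange_baseChange_rat]
  have E₂ : U.quadraticTwist (d : K) = (W.quadraticTwist (d : ℚ)).baseChange K := by
    rw [hU, WeierstrassCurve.baseChange, WeierstrassCurve.baseChange,
      show ((d : K)) = algebraMap ℚ K (d : ℚ) by simp, ← map_quadraticTwist, hW',
      quadraticTwist_quadraticTwist, one_mul]
  have hxy₁ : ((U.quadraticTwist 1).baseChange L).toAffine.Nonsingular x y₀ := E₁ ▸ hxy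
  obtain ⟨R, hR⟩ := QuadraticDescent.exists_twistMap_eq U hθK hθsq hxy₁ ha hb'
  set V : WeierstrassCurve ℚ := W.quadraticTwist (d : ℚ) with hV
  haveI : V.IsElliptic := W.isElliptic_quadraticTwist hdQ
  set Q' : (V.baseChange K).toAffine.Point := Affine.Point.congrEquiv E₂ R with hQ'def
  -- §f the composite `Φ : E^{(d)}(K) → E(L)` through which everything is read
  let Φ : (V.baseChange K).toAffine.Point →+ (W.baseChange L).toAffine.Point :=
    e.symm.toAddMonoidHom.comp <| (Affine.Point.congrEquiv E₁).toAddMonoidHom.comp <|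
      (QuadraticDescent.twistMap U hθK hθsq).comp (Affine.Point.congrEquiv E₂).symm.toAddMonoidHom
  have hΦinj : Function.Injective Φ := by
    show Function.Injective (e.symm ∘ Affine.Point.congrEquiv E₁ ∘ QuadraticDescent.twistMap U hθK hθsq ∘
      (Affine.Point.congrEquiv E₂).symm)
    exact e.symm.injective.comp ((Affine.Point.congrEquiv E₁).injective.comp
      ((QuadraticDescent.twistMap_injective U hθK hθsq).comp (Affine.Point.congrEquiv E₂).symm.injective))
  have hΦQ' : Φ Q' = Ps := by
    show e.symm (Affine.Point.congrEquiv E₁ (QuadraticDescent.twistMap U hθK hθsq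
      ((Affine.Point.congrEquiv E₂).symm Q'))) = Ps
    rw [hQ'def, AddEquiv.symm_apply_apply, hR, Affine.Point.congrEquiv_some, ← hPxy, hPdef,
      AddEquiv.symm_apply_apply]
  -- §g `E^{(d)}(K)[2] = 0` and `Q'` is not twice a point
  have h2K : ∀ Q : (V.baseChange K).toAffine.Point, (2 : ℕ) • Q = 0 → Q = 0 := by
    intro Q hQ
    apply hΦinj
    rw [_root_.map_zero]
    exact h2L _ (by rw [← map_nsmul, hQ, _root_.map_zero])
  have hQ' : ¬ ∃ R₂ : (V.baseChange K).toAffine.Point, (2 : ℕ) • R₂ = Q' := by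
    rintro ⟨R₂, hR₂⟩
    -- then `P(s) = 2 · Φ R₂`, contradicting the parity transport of (H-y)
    have hPs2 : Ps - (2 : ℕ) • Φ R₂ = 0 := by rw [← map_nsmul, hR₂, hΦQ', sub_self]
    let ρ : (L ≃ₐ[K] L) → AddMonoid.End (W.baseChange L).toAffine.Point := fun σ =>
      Affine.Point.map (W' := W) (σ : L →ₐ[K] L)
    set yL : (W.baseChange L).toAffine.Point := Affine.Point.baseChange (W' := W) K L yK with hyL
    have hyfix : ∀ σ : L ≃ₐ[K] L, ρ σ yL = yL := fun σ =>
      Affine.Point.map_baseChange (W' := W) (σ : L →ₐ[K] L) yK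
    have hndiv : ¬ ∃ R₀ : (W.baseChange L).toAffine.Point,
        (∀ σ : L ≃ₐ[K] L, ρ σ R₀ = R₀) ∧ (2 : ℕ) • R₀ = yL := by
      rintro ⟨R₀, hfix, hR₀⟩
      obtain ⟨R₁, hR₁⟩ := exists_map_eq_of_forall_map_galois_eq (k := K) (L := L) W (P := R₀) hfix
      apply hHy
      refine ⟨R₁, ?_⟩
      apply Affine.Point.map_injective (W' := W) ((algebraMap K L).toRatAlgHom)
      rw [map_nsmul, hR₁, hR₀, hyL, map_toRatAlgHom_eq_baseChange]
    obtain ⟨Q₀, hQ₀⟩ := GenusCongruence.exists_sum_units_smul_sub_sum_eq_two_nsmul Finset.univ s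
      fun σ : L ≃ₐ[K] L => Affine.Point.map (W' := W) (σ : L →ₐ[K] L) y
    have hQ₀' : Ps - m₀ • yL = (2 : ℕ) • Q₀ := by rw [← hQ₀, hPs, ← htr]
    have hkey : Ps - (2 : ℕ) • Φ R₂ - m₀ • yL = (2 : ℕ) • (Q₀ - Φ R₂) := by
      rw [nsmul_sub, ← hQ₀']
      abel
    have hfin : ¬ IsOfFinAddOrder (Ps - (2 : ℕ) • Φ R₂) :=
      GenusCongruence.not_isOfFinAddOrder_of_sub_smul_eq_two_nsmul ρ h2L hyfix hndiv hm₀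
        ⟨Q₀ - Φ R₂, hkey⟩
    exact hfin (by rw [hPs2]; exact IsOfFinAddOrder.zero)
  -- §h the ℚ-level engine on `Q'`
  have hrk₀ : (V.quadraticTwist (NumberField.discr K : ℚ)).mordellWeilRank = 0 := by
    obtain ⟨C₂, hC₂⟩ := h₂
    rw [hV, quadraticTwist_quadraticTwist, show (d : ℚ) * (NumberField.discr K : ℚ) =
      ((d * NumberField.discr K : ℤ) : ℚ) by push_cast; ring, ← hC₂,
      mordellWeilRank_variableChange_holds W₂ C₂]
    exact hrk₂
  obtain ⟨a₀, k, ha₀, hk, hheight⟩ :=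
    exists_odd_sq_mul_canonicalHeight_eq V W₁ h₁ K hK2 hrk₁ hrk₀ h2K Q' hQ'
  -- §i heights: `ĥ_L(P(s)) = [L:K] · ĥ_K(Q')`
  have hhP : canonicalHeight Ps = (finrank K L : ℝ) * canonicalHeight Q' := by
    have h1 : canonicalHeight Ps = canonicalHeight P := by rw [hPdef, he_h]
    have h2 : canonicalHeight P =
        canonicalHeight (QuadraticDescent.twistMap U hθK hθsq R) := by
      rw [hR, hPxy]
      exact (canonicalHeight_congrEquiv E₁.symm (.some x y₀ hxy)).symm.trans
        (by rw [Affine.Point.congrEquiv_some])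
    have h3 : canonicalHeight (QuadraticDescent.twistMap U hθK hθsq R) =
        (finrank K L : ℝ) * canonicalHeight R := by
      show canonicalHeight (Affine.Point.congrEquiv _ (VariableChange.pointEquiv _ _
        (QuadraticDescent.incl L (U.quadraticTwist (d : K)) R))) = _
      rw [canonicalHeight_congrEquiv, canonicalHeight_pointEquiv]
      exact canonicalHeight_baseChange (R := K) (W := U.quadraticTwist (d : K)) (K := K) (L := L) R
    have h4 : canonicalHeight Q' = canonicalHeight R := by
      rw [hQ'def, canonicalHeight_congrEquiv]
    rw [h1, h2, h3, h4]
  refine ⟨a₀, k, ha₀, hk, ?_⟩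
  rw [hhP, ← mul_assoc, mul_comm ((k : ℝ) ^ 2), mul_assoc, hheight]
  ring

end Transport

end Summit.BirchSwinnertonDyer.Uniform.U2.HeegnerIndex

end
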